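import Literature.AnabelianGeometry.AbsoluteAnabelian.MonoidKummerMapsTLGLiftOfFiniteIndexOpen
import Summits.BirchSwinnertonDyer.Rank1Residual.GaloisImage.LocalEulerPoincareCharacteristicHolds
import HarnessLib

/-!
# [AbsTopIII] Prop 3.2 (iv) / 3.3 (ii): the `TLG`/`TCG` lifting sentences and the named facts
# F-0412 / F-0409 (every `H`) / F-0413 (every `H`) MODULO THE SINGLE NAMED FACT F-1977 (Nikolov–Segal)

Cell `abc-iut` (run/shared/lean/pub/abc-iut/), FACT-LIST rows F-0412 `UnitPairIsoFibres` (closed; cone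
node AbsTopIII:Prop3.3(ii)), F-0409 `GaloisIsoLiftsToTMPairIso H`, F-0413 `UnitPairIsoFibresOfType H`
(schemata; AbsTopIII:Prop3.2(iv)/3.3(ii)).  The Literature file
`MonoidKummerMapsTLGLiftOfFiniteIndexOpen.lean` (abc-iut-L6-t13) derives them from two hypotheses:
`hNS : Rmk253.FiniteIndexOpenOfTopFG` (FACT-LIST F-1977, the Nikolov–Segal theorem quoted in
[IUTchI] Rmk. 2.5.3 (vi), consumed BY NAME) and `hEP` (Tate's local Euler–Poincaré characteristic
for all `p`-adic local fields, through [NSW] Thm. 7.5.10 "`G_k` is topologically finitely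
generated").  `hEP` is PROVED in the tree, but Summits-side (`localEulerPoincareCharacteristic_holds`,
cell `b2b-bsdres`); a Literature file may not import a Summits file, so — exactly as for
`Summits/ABC/IUTFork/MLFGaloisTFG.lean` — the statements with `hEP` DISCHARGED are assembled HERE,
leaving the single residual hypothesis F-1977:

* `forall_finiteIndex_isOpen_absoluteGaloisGroup_of_finiteIndexOpenOfTopFG'` — finite-index
  subgroups of `Gal(k̄/k)` are open (`k` a non-archimedean local field of characteristic `0`),
  from F-1977 alone;
* `biAnabelianUnits_abstract_of_finiteIndexOpenOfTopFG'` — (BA_abs) of abc-iut-L6-d1's reduction;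
* `tlgLifting_of_finiteIndexOpenOfTopFG'`, `tcgLifting_of_finiteIndexOpenOfTopFG'` — the lifting
  sentences for ALL MLF-Galois `TLG` / `TCG`-pairs;
* `unitPairIsoFibres_of_finiteIndexOpenOfTopFG : FiniteIndexOpenOfTopFG → UnitPairIsoFibres` (F-0412),
  `galoisIsoLiftsToTMPairIso_of_finiteIndexOpenOfTopFG … H` (F-0409, every `H`),
  `unitPairIsoFibresOfType_of_finiteIndexOpenOfTopFG … H` (F-0413, every `H`).

HONEST FRAMING: OUR kernel proof of statements of a refereed paper ([AbsTopIII] 2015) modulo ONE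
named classical fact (Nikolov–Segal 2003/2007), which is an assumption label, not an endorsement;
the compact-`Π` instances (`galoisIsoLiftsToTMPairIso_of_compact_holds`,
`unitPairIsoFibresOfType_of_compact_holds`) and the mono-analytic facts F-0410/F-0411 remain
unconditional.  Nothing here bears on [IUTchIII] Cor. 3.12 or asserts that abc is proved or refuted.

## References

* S. Mochizuki, *Topics in Absolute Anabelian Geometry III* (2015), Prop. 3.2 (iv), 3.3 (ii).
  [MochizukiAbsTopIII2015]
* S. Mochizuki, *Inter-universal Teichmüller Theory I*, Rmk. 2.5.3 (vi) (the quoted theorem of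
  Nikolov–Segal). [Mochizuki2012]
* J. Neukirch, A. Schmidt, K. Wingberg, *Cohomology of Number Fields* (2008), Thm. 7.5.10.
  [NeukirchSchmidtWingberg2008]
-/

noncomputable section

open scoped nonZeroDivisors

namespace Summit.ABC.IUTFork

open Field Literature.AnabelianGeometry.AbsoluteAnabelian Literature.NumberTheory.GaloisRepresentations
open Literature.IUT.HodgeTheaters.Rmk253 (FiniteIndexOpenOfTopFG)

/-- **Finite-index subgroups of `Gal(k̄/k)` are open**, for every non-archimedean local field `k` of
characteristic `0`, FROM the Nikolov–Segal theorem BY NAME (F-1977) alone — Tate's Euler–Poincaré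
characteristic supplied by the tree's `localEulerPoincareCharacteristic_holds`.
[cite: NeukirchSchmidtWingberg2008, Thm. 7.5.10] [cite: Mochizuki2012, IUTchI Rmk 2.5.3 (vi) (O3) p.56] -/
theorem forall_finiteIndex_isOpen_absoluteGaloisGroup_of_finiteIndexOpenOfTopFG'
    (hNS : FiniteIndexOpenOfTopFG.{0}) (k : Type) [Field k] [ValuativeRel k] [TopologicalSpace k]
    [IsNonarchimedeanLocalField k] [CharZero k] (U : Subgroup (absoluteGaloisGroup k))
    (hU : U.FiniteIndex) : IsOpen (U : Set (absoluteGaloisGroup k)) :=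
  forall_finiteIndex_isOpen_absoluteGaloisGroup_of_finiteIndexOpenOfTopFG k hNS
    (localEulerPoincareCharacteristic_holds k) U hU

/-- **(BA_abs) modulo F-1977 alone**: every ABSTRACT isomorphism of the Galois groups of two MLF
closure data admits an equivariant multiplicative bijection of the `k̄^×`.
[cite: MochizukiAbsTopIII2015, Proposition 3.2 (iv) p.72] -/
theorem biAnabelianUnits_abstract_of_finiteIndexOpenOfTopFG' (hNS : FiniteIndexOpenOfTopFG.{0})
    (C₁ C₂ : MLFClosure.{0}) (α : (C₁.K ≃ₐ[C₁.k] C₁.K) ≃* (C₂.K ≃ₐ[C₂.k] C₂.K)) :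
    ∃ β : ↥(nonZeroDivisors C₁.K) ≃* ↥(nonZeroDivisors C₂.K),
      ∀ (σ : C₁.K ≃ₐ[C₁.k] C₁.K) (x y : ↥(nonZeroDivisors C₁.K)), (y : C₁.K) = σ x →
        ((β y : ↥(nonZeroDivisors C₂.K)) : C₂.K) = α σ ((β x : ↥(nonZeroDivisors C₂.K)) : C₂.K) :=
  biAnabelianUnits_abstract_of_finiteIndexOpenOfTopFG hNS
    (fun F _ _ _ _ _ => localEulerPoincareCharacteristic_holds F) C₁ C₂ α

/-- **The `TLG` lifting sentence for ALL MLF-Galois `TLG`-pairs modulo F-1977 alone** ([AbsTopIII]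
Prop. 3.3 (ii) surjectivity): every admissible `Π ⥲ Π*` lifts to an isomorphism of pairs.
[cite: MochizukiAbsTopIII2015, Proposition 3.3 (ii) p.74] -/
theorem tlgLifting_of_finiteIndexOpenOfTopFG' (hNS : FiniteIndexOpenOfTopFG.{0})
    (P Q : GaloisMonoidPair.{0}) (hP : IsMLFGaloisMonoidPair .TLG P) (hQ : IsMLFGaloisMonoidPair .TLG Q)
    (f : P.Pi ≃ₜ* Q.Pi) (hf : P.actionKer.map f.toMulEquiv.toMonoidHom = Q.actionKer) :
    ∃ e : GaloisMonoidPair.Iso P Q, e.isoPi = f :=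
  tlgLifting_of_finiteIndexOpenOfTopFG hNS (fun F _ _ _ _ _ => localEulerPoincareCharacteristic_holds F)
    P Q hP hQ f hf

/-- **The `TCG` lifting sentence for ALL MLF-Galois `TCG`-pairs modulo F-1977 alone** ([AbsTopIII]
Prop. 3.3 (ii)). [cite: MochizukiAbsTopIII2015, Proposition 3.3 (ii) p.74] -/
theorem tcgLifting_of_finiteIndexOpenOfTopFG' (hNS : FiniteIndexOpenOfTopFG.{0})
    (P Q : GaloisMonoidPair.{0}) (hP : IsMLFGaloisMonoidPair .TCG P) (hQ : IsMLFGaloisMonoidPair .TCG Q)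
    (f : P.Pi ≃ₜ* Q.Pi) (hf : P.actionKer.map f.toMulEquiv.toMonoidHom = Q.actionKer) :
    ∃ e : GaloisMonoidPair.Iso P Q, e.isoPi = f :=
  tcgLifting_of_finiteIndexOpenOfTopFG hNS (fun F _ _ _ _ _ => localEulerPoincareCharacteristic_holds F)
    P Q hP hQ f hf

/-- **F-0412 `UnitPairIsoFibres` MODULO F-1977 ALONE** ([AbsTopIII] Prop. 3.3 (ii), pre-erratum
named fact of abc-iut-L4-t2; both conjuncts). [cite: MochizukiAbsTopIII2015, Proposition 3.3 (ii) p.74] -/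
theorem unitPairIsoFibres_of_finiteIndexOpenOfTopFG (hNS : FiniteIndexOpenOfTopFG.{0}) :
    Literature.AnabelianGeometry.AbsoluteAnabelian.UnitPairIsoFibres :=
  unitPairIsoFibres_of_finiteIndexOpenOfTopFG_of_localEPC hNS
    (fun F _ _ _ _ _ => localEulerPoincareCharacteristic_holds F)

/-- **F-0409 `GaloisIsoLiftsToTMPairIso H` for EVERY `H`, MODULO F-1977 ALONE** ([AbsTopIII]
Prop. 3.2 (iv), author's corrected form). [cite: MochizukiAbsTopIII2015, Proposition 3.2 (iv) p.72]
[cite: MochizukiAbsTopIIIComments2019, item (5)] -/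
theorem galoisIsoLiftsToTMPairIso_of_finiteIndexOpenOfTopFG (hNS : FiniteIndexOpenOfTopFG.{0})
    (H : GaloisMonoidPair.{0} → Prop) :
    Literature.AnabelianGeometry.AbsoluteAnabelian.GaloisIsoLiftsToTMPairIso H :=
  galoisIsoLiftsToTMPairIso_of_finiteIndexOpenOfTopFG_of_localEPC hNS
    (fun F _ _ _ _ _ => localEulerPoincareCharacteristic_holds F) H

/-- **F-0413 `UnitPairIsoFibresOfType H` for EVERY `H`, MODULO F-1977 ALONE** ([AbsTopIII]
Prop. 3.3 (ii) as corrected, both clauses). [cite: MochizukiAbsTopIII2015, Proposition 3.3 (ii) p.74]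
[cite: MochizukiAbsTopIIIComments2019, item (5)] -/
theorem unitPairIsoFibresOfType_of_finiteIndexOpenOfTopFG (hNS : FiniteIndexOpenOfTopFG.{0})
    (H : GaloisMonoidPair.{0} → Prop) :
    Literature.AnabelianGeometry.AbsoluteAnabelian.UnitPairIsoFibresOfType H :=
  unitPairIsoFibresOfType_of_finiteIndexOpenOfTopFG_of_localEPC hNS
    (fun F _ _ _ _ _ => localEulerPoincareCharacteristic_holds F) H

end Summit.ABC.IUTFork

end
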